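import Summits.BirchSwinnertonDyer.BirchSwinnertonDyer.Theorems.GenusKolyvaginAtTwoPowDvdShaCardAtTwoRTOrderFourAuxiliary
import HarnessLib

/-!
# Route `GenusKolyvaginAtTwo`, crux L_T `PowDvdShaCardAtTwoRT` (stmt-BirchSwinnertonDyer-23242), LINE 18 stub L, bottom rung at LEVEL 2:
# THE AUXILIARY CLASS VANISHING AT THE GENUS PLACES exists as soon as `4^δ ≤ 4^k` — the exact count
# `#𝒴² · ∏_{p∈D} #H¹(ℚ_p, E[2]) = 4^{#S} · #𝒴*²`

LEAD seat `bsd-line-gk2-p1` g16 (cell `bsd-f1-sign2`), `--supports 23242 --as helper`.  THEOREMS ONLY; no `sorry`; standard axioms.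
BSD is NOT proved by any of this; neither is the crux nor stub L.

WHY (memo `Cruxes/PowDvdShaCardAtTwoRT/Lines/plus-descent-lead-g16.md` §3).  With an index-1 prime in the Kolyvagin witness the bottom-rung
engine runs at level `2`: the auxiliary `y ∈ H¹(ℚ, E[2])` must be Kummer off the own primes `S` and the genus places `D = {p ∣ d_K}`,
free on `S`, and ZERO on `D`; its dual structure is «zero on `S`, free on `D`» and contains the descended minimal Kolyvagin class `b ≠ 0`.
This file gives the EXACT count of that solution group 𝒴 against its dual 𝒴* — `#𝒴² · ∏_{u∈D} #H¹(ℚ_u, E[2]) = 4^{#S} · #𝒴*²`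
(`#H¹(ℚ_ℓ, E[2]) = 4` at a Gross–Kolyvagin prime, `…RTOrderFourAuxiliary`; at `p ∈ D` Tate's count `#H¹(ℚ_p,E[2]) = #E(ℚ_p)[2]²` makes the
product `4^δ`, `δ = Σ_{p∣d_K} dim E(ℚ_p)[2] = ord₂ C(Wd)`), hence **a non-zero `y ∈ 𝒴` as soon as `∏_{u∈D} #H¹(ℚ_u,E[2]) ≤ 4^{#S}`
(`δ ≤ k`) and `𝒴* ≠ 0`** — in particular ALWAYS on the generic habitat `δ = ord₂ C(Wd) = 1` (the consensus cut (E1)), for witnesses of ANY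
index.  Inputs: `…RTRelaxedCountKummer.natCard_solutions_mul_eq_kummerOutside_canonical`, gk2-p4 `natCard_map_kummerOutside_sq_places`.
WHAT (namespace `…Theorems.GenusExact.RelaxedCount`): `natCard_sq_mul_prod_eq_levelTwo` (the count; `T` partitioned as `S ⊔ D`, `S` at
Gross–Kolyvagin primes), `exists_ne_zero_levelTwoAuxiliary` (the existence).  Closes nothing.  BSD is NOT proved by any of this.

References: [McCallumLMS1991] §2 Prop. 2.1, §5 proof of Prop. 5.2; [MilneADT2006] Ch. I Thm. 2.8, Thm. 4.10; [Kramer1981] Prop. 3.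
-/

set_option autoImplicit false
-- the Theorems namespace of this sub repeats the summit name by design (D-0017 nested layout)
set_option linter.dupNamespace false

noncomputable section

open scoped Classical

open CategoryTheory Field NumberField IsDedekindDomain Function
open _root_.WeierstrassCurve
open Literature.NumberTheory.EllipticCurves
open Literature.NumberTheory.GaloisRepresentations
open Literature.NumberTheory.GaloisCohomology
open Summit.BirchSwinnertonDyer.Rank1Residual.X11b.KummerPT
open Summit.BirchSwinnertonDyer.Rank1Residual.X11b.FiniteDuality
open Summit.BirchSwinnertonDyer.Rank1Residual.X11b.Relaxation
open Summit.BirchSwinnertonDyer.Rank1Residual.X11b.LocBridge Summit.BirchSwinnertonDyer.Rank1Residual.X11b.Levels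
open Summit.BirchSwinnertonDyer.Rank1Residual.X11b.AcSelmer
open scoped ContRepresentation

namespace Summit.BirchSwinnertonDyer.BirchSwinnertonDyer.Theorems.GenusExact.RelaxedCount

open Summit.BirchSwinnertonDyer.BirchSwinnertonDyer.Theorems.GenusKolyKramer (finite_galoisCohomology_toLocal)
open Summit.BirchSwinnertonDyer.BirchSwinnertonDyer.Theorems.GenusExact.AuxiliaryClass

variable (W : WeierstrassCurve ℚ) [W.IsElliptic] [W.IsGloballyMinimal]

/-- **The exact count of the level-2 auxiliary structure «free on `S`, zero on `D`» against its dual «zero on `S`, free on `D`».**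
`T = S ⊔ D` a finite set of places (`S ⊆ T`, `D = T ∖ S`), `S` at Gross–Kolyvagin primes (`Δ < 0`, `ℓ ≠ 2` good, `Frob_ℓ = Frob_∞`,
index `≥ 1`); with
`𝒴 = {y ∈ H¹_{𝓛,⊤ on S∪D}(ℚ, E[2]) : loc_u y = 0 (u ∈ D)}`, `𝒴* = {b ∈ H¹_{𝓛,⊤ on S∪D}(ℚ, E[2]) : loc_u b = 0 (u ∈ S)}`:
**`#𝒴² · ∏_{u∈D} #H¹(ℚ_u, E[2]) = 4^{#S} · #𝒴*²`**. [cite: McCallumLMS1991, §2 proof of Prop. 2.1] [cite: MilneADT2006, Ch. I, Thm. 4.10] -/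
theorem natCard_sq_mul_prod_eq_levelTwo (hΔ : W.Δ < 0) {K : Type} [Field K] [NumberField K]
    (T S D : Finset (Place ℚ)) (hST : S ⊆ T) (hD : ∀ u, u ∈ D ↔ u ∈ T ∧ u ∉ S)
    (hSK : ∀ u ∈ S, ∃ (v : HeightOneSpectrum (𝓞 ℚ)) (ℓ : ℕ) (_ : Fact ℓ.Prime), u = Sum.inr v ∧ ℓ ≠ 2 ∧ (ℓ : 𝓞 ℚ) ∈ v.asIdeal ∧
      W.HasGoodReductionAtPrime ℓ ∧ FrobEqFrobInfty W K 2 ℓ ∧ 1 ≤ Zhang2014.kolyvaginIndex W 2 ℓ) :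
    Nat.card ↥(kummerOutside W (2 ^ 1) T ⊓ ⨅ u ∈ D, (galoisCohomology.localization (W.torsionGaloisModule
        ((2 ^ 1 : ℕ) : ℤ)) u 1).ker) ^ 2 *
        ∏ u ∈ D, Nat.card (galoisCohomology ((W.torsionGaloisModule ((2 ^ 1 : ℕ) : ℤ)).toLocal u) 1) =
      4 ^ S.card * Nat.card ↥(kummerOutside W (2 ^ 1) T ⊓ ⨅ u ∈ S, (galoisCohomology.localization (W.torsionGaloisModule
        ((2 ^ 1 : ℕ) : ℤ)) u 1).ker) ^ 2 := by
  classical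
  haveI : Fact (Nat.Prime 2) := ⟨Nat.prime_two⟩
  haveI hfin : ∀ u : Place ℚ, Finite (galoisCohomology ((W.torsionGaloisModule ((2 ^ 1 : ℕ) : ℤ)).toLocal u) 1) :=
    fun u ↦ finite_galoisCohomology_toLocal W (2 ^ 1) u
  -- Weil pairing at level 2 and the canonical inputs
  obtain ⟨e, hμ, hadd₁, hadd₂, halt, hnondeg, hgal⟩ := W.exists_weilPairing_holds (2 ^ 1) (by norm_num) (by norm_num)
  haveI : Finite (W.geomTorsion ((2 ^ 1 : ℕ) : ℤ)) := finite_geomTorsion_pow W 2 1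
  have hpp : IsPrimePow (2 ^ 1) := ⟨2, 1, Nat.prime_two.prime, one_pos, rfl⟩
  have hperf := LocalInvariants.canonical_isPerfect (K := ℚ) (n := 2 ^ 1)
  have hsum := Summit.BirchSwinnertonDyer.BirchSwinnertonDyer.Theorems.SchneiderFreeAdditiveX3.PoitouTateReduction.sumLocalTermEqZero_canonical
    (K := ℚ) (2 ^ 1)
  have hcompl := Summit.BirchSwinnertonDyer.BirchSwinnertonDyer.Theorems.SchneiderFreeAdditiveX3.PoitouTateReduction.selmerComplement_canonical_holds
    ℚ (2 ^ 1)
  have hreal : ∀ w' : InfinitePlace ℚ, w'.IsReal →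
      Injective (LocalInvariants.canonical ℚ (2 ^ 1) (Sum.inl w')) := fun w' hw' ↦ by
    rw [LocalInvariants.canonical_inl]; exact archimedeanInvariantMap_injective_of_isReal hw'
  have hEuler : ∀ v : HeightOneSpectrum (𝓞 ℚ),
      Nat.card (galoisCohomology ((W.torsionGaloisModule ((2 ^ 1 : ℕ) : ℤ)).toLocal (Sum.inr v)) 1) =
        (Nat.card (nsmulAddMonoidHom (2 ^ 1) :
            (W.baseChange (v.adicCompletion ℚ)).toAffine.Point →+ _).ker *
          Nat.card (v.adicCompletionIntegers ℚ ⧸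
            Ideal.span {((2 ^ 1 : ℕ) : v.adicCompletionIntegers ℚ)})) ^ 2 := fun v ↦ by
    haveI : CharZero (v.adicCompletion ℚ) := charZero_adicCompletion v
    exact natCard_galoisCohomology_one_torsion_adicCompletion_eq_sq W v (2 ^ 1) hpp
      (localEulerPoincareCharacteristic_holds (v.adicCompletion ℚ))
  -- product localisation and the local conditions `⊤` on `S`, `⊥` on `D`
  set loc : galoisCohomology (W.torsionGaloisModule ((2 ^ 1 : ℕ) : ℤ)) 1 →+
      (∀ u : ↥T, galoisCohomology ((W.torsionGaloisModule ((2 ^ 1 : ℕ) : ℤ)).toLocal (u : Place ℚ)) 1) :=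
    AddMonoidHom.pi fun u ↦ galoisCohomology.localization (W.torsionGaloisModule ((2 ^ 1 : ℕ) : ℤ)) (u : Place ℚ) 1 with hlocd
  have hloc : ∀ c u, loc c u = galoisCohomology.localization (W.torsionGaloisModule ((2 ^ 1 : ℕ) : ℤ)) (u : Place ℚ) 1 c :=
    fun c u ↦ rfl
  set M : ∀ u : ↥T, AddSubgroup (galoisCohomology ((W.torsionGaloisModule ((2 ^ 1 : ℕ) : ℤ)).toLocal (u : Place ℚ)) 1) :=
    fun u ↦ if (u : Place ℚ) ∈ S then ⊤ else ⊥ with hMdef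
  -- identification of the two solution groups with the displayed ones
  have hmemS : ∀ u : ↥T, (u : Place ℚ) ∉ S → (u : Place ℚ) ∈ D := fun u hu ↦ (hD _).mpr ⟨u.2, hu⟩
  have hY : kummerOutside W (2 ^ 1) T ⊓ (AddSubgroup.pi Set.univ M).comap loc =
      kummerOutside W (2 ^ 1) T ⊓ ⨅ u ∈ D, (galoisCohomology.localization (W.torsionGaloisModule
        ((2 ^ 1 : ℕ) : ℤ)) u 1).ker := by
    ext c
    simp only [AddSubgroup.mem_inf, AddSubgroup.mem_comap, AddSubgroup.mem_pi, Set.mem_univ, true_implies,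
      AddSubgroup.mem_iInf, AddMonoidHom.mem_ker]
    refine and_congr_right fun _ ↦ ⟨fun h u hu ↦ ?_, fun h u ↦ ?_⟩
    · have h1 := h ⟨u, ((hD u).mp hu).1⟩
      have hnS : u ∉ S := ((hD u).mp hu).2
      rw [hMdef] at h1
      simp only [hnS, if_false, AddSubgroup.mem_bot] at h1
      exact h1
    · rw [hMdef]
      by_cases huS : (u : Place ℚ) ∈ S
      · simp only [huS, if_true]; exact AddSubgroup.mem_top _
      · simp only [huS, if_false, AddSubgroup.mem_bot, hloc]
        exact h u (hmemS u huS)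
  have hY' : kummerOutside W (2 ^ 1) T ⊓ (AddSubgroup.pi Set.univ (fun u : ↥T ↦
        annLeft (invWeilPairing W (2 ^ 1) e hμ hadd₁ hadd₂ hgal (LocalInvariants.canonical ℚ (2 ^ 1)) (u : Place ℚ)) (M u))).comap loc =
      kummerOutside W (2 ^ 1) T ⊓ ⨅ u ∈ S, (galoisCohomology.localization (W.torsionGaloisModule
        ((2 ^ 1 : ℕ) : ℤ)) u 1).ker := by
    have hinj : ∀ u : ↥T, Injective (invWeilPairing W (2 ^ 1) e hμ hadd₁ hadd₂ hgal (LocalInvariants.canonical ℚ (2 ^ 1))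
        (u : Place ℚ)) := fun u ↦
      (invWeilPairing_bijective_place W (2 ^ 1) e hμ hadd₁ hadd₂ hgal halt hnondeg _ hperf hreal (u : Place ℚ)).1
    ext c
    simp only [AddSubgroup.mem_inf, AddSubgroup.mem_comap, AddSubgroup.mem_pi, Set.mem_univ, true_implies,
      AddSubgroup.mem_iInf, AddMonoidHom.mem_ker]
    refine and_congr_right fun _ ↦ ⟨fun h u hu ↦ ?_, fun h u ↦ ?_⟩
    · have h1 := h ⟨u, hST hu⟩
      rw [hMdef] at h1
      simp only [hu, if_true] at h1
      -- `loc_u c ∈ {}^⊥⊤ = 0`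
      change loc c ⟨u, hST hu⟩ = 0
      apply hinj ⟨u, hST hu⟩
      ext x
      rw [map_zero, AddMonoidHom.zero_apply]
      exact (mem_annLeft_iff _ _ _).mp h1 x (AddSubgroup.mem_top _)
    · rw [hMdef, mem_annLeft_iff]
      intro x hx
      by_cases huS : (u : Place ℚ) ∈ S
      · simp only [hloc, h u huS, map_zero, AddMonoidHom.zero_apply]
      · simp only [huS, if_false, AddSubgroup.mem_bot] at hx
        rw [hx, map_zero]
  -- the two counts
  have h1 := natCard_solutions_mul_eq_kummerOutside W 2 1 e hμ hadd₁ hadd₂ hgal halt hnondeg hperf hsum hcompl hEuler hreal T loc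
    hloc M
  have hG := natCard_map_kummerOutside_sq_places W 2 1 e hμ hadd₁ hadd₂ hgal halt hnondeg hperf hsum hcompl hEuler hreal T loc hloc
  rw [hY, hY'] at h1
  -- `∏_u #M_u = 4^{#S}` and `∏_{v∈T} #H¹_v = 4^{#S} · ∏_{u∈D} #H¹_u`
  have hcount : ∀ u ∈ S, Nat.card (galoisCohomology ((W.torsionGaloisModule ((2 ^ 1 : ℕ) : ℤ)).toLocal u) 1) = 4 := by
    intro u hu
    obtain ⟨v, ℓ, hℓp, huv, hℓ2, hv, hgood, hFrob, hidx⟩ := hSK u hu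
    rw [huv, natCard_galoisCohomology_one_toLocal_two_pow_eq W hΔ hℓ2 hgood hFrob hv one_ne_zero hidx, pow_one]
  have hMu : ∀ u : ↥T, Nat.card (M u) =
      (if (u : Place ℚ) ∈ S then Nat.card (galoisCohomology ((W.torsionGaloisModule ((2 ^ 1 : ℕ) : ℤ)).toLocal (u : Place ℚ)) 1)
        else 1) := by
    intro u
    rw [hMdef]
    by_cases hu : (u : Place ℚ) ∈ S
    · simp only [hu, if_true]; exact AddSubgroup.card_top
    · simp only [hu, if_false]; exact AddSubgroup.card_bot
  -- the partition `T = S ⊔ D` for products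
  have hfilt : T.filter (· ∈ S) = S := by
    ext u; simp only [Finset.mem_filter]; exact ⟨fun h ↦ h.2, fun h ↦ ⟨hST h, h⟩⟩
  have hfilt' : T.filter (fun u ↦ ¬ u ∈ S) = D := by
    ext u; rw [Finset.mem_filter, hD]
  have hsplit : ∀ f : Place ℚ → ℕ, ∏ v ∈ T, f v = (∏ v ∈ S, f v) * ∏ v ∈ D, f v := fun f ↦ by
    rw [← Finset.prod_filter_mul_prod_filter_not T (· ∈ S), hfilt, hfilt']
  have hM : (∏ u : ↥T, Nat.card (M u)) = 4 ^ S.card := by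
    rw [Finset.prod_congr rfl fun u _ ↦ hMu u,
      Finset.prod_coe_sort T (fun v : Place ℚ ↦ if v ∈ S then
        Nat.card (galoisCohomology ((W.torsionGaloisModule ((2 ^ 1 : ℕ) : ℤ)).toLocal v) 1) else 1),
      hsplit, Finset.prod_ite_mem, Finset.inter_self, Finset.prod_congr rfl fun u hu ↦ hcount u hu, Finset.prod_const]
    have hD1 : ∏ v ∈ D, (if v ∈ S then
        Nat.card (galoisCohomology ((W.torsionGaloisModule ((2 ^ 1 : ℕ) : ℤ)).toLocal v) 1) else 1) = 1 :=
      Finset.prod_eq_one fun v hv ↦ by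
        have hvS : v ∉ S := ((hD v).mp hv).2
        simp only [hvS, if_false]
    rw [hD1, mul_one]
  have hGsplit : ∏ v ∈ T, Nat.card (galoisCohomology ((W.torsionGaloisModule ((2 ^ 1 : ℕ) : ℤ)).toLocal v) 1) =
      4 ^ S.card * ∏ u ∈ D, Nat.card (galoisCohomology ((W.torsionGaloisModule ((2 ^ 1 : ℕ) : ℤ)).toLocal u) 1) := by
    rw [hsplit, Finset.prod_congr rfl fun u hu ↦ hcount u hu, Finset.prod_const]
  rw [hM] at h1
  rw [hGsplit] at hG
  -- `(#𝒴·#G)² = #𝒴²·4^{#S}·P_D = 16^{#S}·#𝒴*²`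
  have h2 := congrArg (fun x : ℕ ↦ x ^ 2) h1
  simp only [mul_pow] at h2
  rw [hG] at h2
  have h4 : (4 : ℕ) ^ S.card ≠ 0 := pow_ne_zero _ (by norm_num)
  have key : Nat.card ↥(kummerOutside W (2 ^ 1) T ⊓ ⨅ u ∈ D, (galoisCohomology.localization (W.torsionGaloisModule
        ((2 ^ 1 : ℕ) : ℤ)) u 1).ker) ^ 2 *
        ∏ u ∈ D, Nat.card (galoisCohomology ((W.torsionGaloisModule ((2 ^ 1 : ℕ) : ℤ)).toLocal u) 1) =
      4 ^ S.card * Nat.card ↥(kummerOutside W (2 ^ 1) T ⊓ ⨅ u ∈ S, (galoisCohomology.localization (W.torsionGaloisModule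
        ((2 ^ 1 : ℕ) : ℤ)) u 1).ker) ^ 2 := by
    apply mul_left_cancel₀ h4
    calc 4 ^ S.card * (Nat.card ↥(kummerOutside W (2 ^ 1) T ⊓ ⨅ u ∈ D, (galoisCohomology.localization
            (W.torsionGaloisModule ((2 ^ 1 : ℕ) : ℤ)) u 1).ker) ^ 2 *
            ∏ u ∈ D, Nat.card (galoisCohomology ((W.torsionGaloisModule ((2 ^ 1 : ℕ) : ℤ)).toLocal u) 1))
        = Nat.card ↥(kummerOutside W (2 ^ 1) T ⊓ ⨅ u ∈ D, (galoisCohomology.localization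
            (W.torsionGaloisModule ((2 ^ 1 : ℕ) : ℤ)) u 1).ker) ^ 2 *
            (4 ^ S.card * ∏ u ∈ D, Nat.card (galoisCohomology ((W.torsionGaloisModule ((2 ^ 1 : ℕ) : ℤ)).toLocal u) 1)) := by
          ring
      _ = (4 ^ S.card) ^ 2 * Nat.card ↥(kummerOutside W (2 ^ 1) T ⊓ ⨅ u ∈ S, (galoisCohomology.localization
            (W.torsionGaloisModule ((2 ^ 1 : ℕ) : ℤ)) u 1).ker) ^ 2 := h2
      _ = 4 ^ S.card * (4 ^ S.card * Nat.card ↥(kummerOutside W (2 ^ 1) T ⊓ ⨅ u ∈ S, (galoisCohomology.localization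
            (W.torsionGaloisModule ((2 ^ 1 : ℕ) : ℤ)) u 1).ker) ^ 2) := by ring
  exact key

/-- **THE LEVEL-2 AUXILIARY EXISTS WHEN `δ ≤ k`.**  Same `S`, `D`; if `∏_{u∈D} #H¹(ℚ_u, E[2]) ≤ 4^{#S}` (at the genus places
`#H¹(ℚ_p, E[2]) = #E(ℚ_p)[2]²`, so this is `δ = Σ_{p∣d_K} dim E(ℚ_p)[2] ≤ #S`; automatic on the habitat `δ = ord₂ C(Wd) = 1`) and the dual
structure «Kummer off `S ∪ D`, zero on `S`, free on `D`» has a non-zero element `b` (the descended Kolyvagin class of a divisor-minimal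
primitive product: memo §3), then there is a non-zero `y ∈ H¹_{𝓛,⊤ on T}(ℚ, E[2])` (`T = S ⊔ D`) vanishing at every place of `D` (and free on `S`).
[cite: McCallumLMS1991, §2 Prop. 2.1 and §5 proof of Prop. 5.2] [cite: Kramer1981, Prop. 3] -/
theorem exists_ne_zero_levelTwoAuxiliary (hΔ : W.Δ < 0) {K : Type} [Field K] [NumberField K]
    (T S D : Finset (Place ℚ)) (hST : S ⊆ T) (hD : ∀ u, u ∈ D ↔ u ∈ T ∧ u ∉ S)
    (hSK : ∀ u ∈ S, ∃ (v : HeightOneSpectrum (𝓞 ℚ)) (ℓ : ℕ) (_ : Fact ℓ.Prime), u = Sum.inr v ∧ ℓ ≠ 2 ∧ (ℓ : 𝓞 ℚ) ∈ v.asIdeal ∧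
      W.HasGoodReductionAtPrime ℓ ∧ FrobEqFrobInfty W K 2 ℓ ∧ 1 ≤ Zhang2014.kolyvaginIndex W 2 ℓ)
    (hδ : ∏ u ∈ D, Nat.card (galoisCohomology ((W.torsionGaloisModule ((2 ^ 1 : ℕ) : ℤ)).toLocal u) 1) ≤ 4 ^ S.card)
    {b : galoisCohomology (W.torsionGaloisModule ((2 ^ 1 : ℕ) : ℤ)) 1} (hbT : b ∈ kummerOutside W (2 ^ 1) T)
    (hbS : ∀ u ∈ S, galoisCohomology.localization (W.torsionGaloisModule ((2 ^ 1 : ℕ) : ℤ)) u 1 b = 0) (hb : b ≠ 0) :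
    ∃ y ∈ kummerOutside W (2 ^ 1) T,
      (∀ u ∈ D, galoisCohomology.localization (W.torsionGaloisModule ((2 ^ 1 : ℕ) : ℤ)) u 1 y = 0) ∧ y ≠ 0 := by
  haveI : Fact (Nat.Prime 2) := ⟨Nat.prime_two⟩
  have hcount := natCard_sq_mul_prod_eq_levelTwo W hΔ T S D hST hD hSK
  set Y := kummerOutside W (2 ^ 1) T ⊓ ⨅ u ∈ D, (galoisCohomology.localization (W.torsionGaloisModule
    ((2 ^ 1 : ℕ) : ℤ)) u 1).ker with hYdef
  set Y' := kummerOutside W (2 ^ 1) T ⊓ ⨅ u ∈ S, (galoisCohomology.localization (W.torsionGaloisModule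
    ((2 ^ 1 : ℕ) : ℤ)) u 1).ker with hY'def
  -- finiteness and `#Y* ≥ 2`
  have hfinKO : Finite (kummerOutside W (2 ^ 1) T) :=
    Summit.BirchSwinnertonDyer.Rank1Residual.X11b.SelmerLevelBound.finite_kummerOutside W (2 ^ 1) T
  haveI : Finite Y := Finite.of_injective _ (AddSubgroup.inclusion_injective (inf_le_left : Y ≤ _))
  haveI : Finite Y' := Finite.of_injective _ (AddSubgroup.inclusion_injective (inf_le_left : Y' ≤ _))
  have hbY' : b ∈ Y' := by
    rw [hY'def]
    exact AddSubgroup.mem_inf.mpr ⟨hbT, AddSubgroup.mem_iInf.mpr fun u ↦ AddSubgroup.mem_iInf.mpr fun hu ↦ hbS u hu⟩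
  have h2 : 2 ≤ Nat.card Y' := by
    have h1 : 1 < Nat.card Y' :=
      Finite.one_lt_card_iff_nontrivial.mpr ⟨⟨⟨b, hbY'⟩, 0, fun h ↦ hb (congrArg Subtype.val h)⟩⟩
    omega
  -- `#Y² · P_D = 4^{#S} · #Y*² ≥ 4^{#S} · 4 > 4^{#S} ≥ P_D`, so `#Y ≥ 2`
  have h4pos : 0 < (4 : ℕ) ^ S.card := pow_pos (by norm_num) _
  have hY2 : 2 ≤ Nat.card Y := by
    by_contra hlt
    push Not at hlt
    have hle : Nat.card Y ^ 2 ≤ 1 := by nlinarith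
    have h3 : 4 ^ S.card * 4 ≤ 4 ^ S.card :=
      calc 4 ^ S.card * 4 ≤ 4 ^ S.card * Nat.card Y' ^ 2 := Nat.mul_le_mul_left _ (by nlinarith)
        _ = Nat.card Y ^ 2 * ∏ u ∈ D, Nat.card (galoisCohomology ((W.torsionGaloisModule ((2 ^ 1 : ℕ) : ℤ)).toLocal u) 1) :=
            hcount.symm
        _ ≤ 1 * 4 ^ S.card := Nat.mul_le_mul hle hδ
        _ = 4 ^ S.card := one_mul _
    omega
  -- a non-zero element of `Y`
  haveI : Nontrivial Y := Finite.one_lt_card_iff_nontrivial.mp (by omega)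
  obtain ⟨⟨y, hyY⟩, hy⟩ := exists_ne (0 : Y)
  have hy0 : y ≠ 0 := fun h ↦ hy (Subtype.ext h)
  rw [hYdef] at hyY
  obtain ⟨hyT, hyD⟩ := AddSubgroup.mem_inf.mp hyY
  exact ⟨y, hyT, fun u hu ↦ AddSubgroup.mem_iInf.mp (AddSubgroup.mem_iInf.mp hyD u) hu, hy0⟩

end Summit.BirchSwinnertonDyer.BirchSwinnertonDyer.Theorems.GenusExact.RelaxedCount

end
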